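import Summits.RiemannHypothesis.RiemannHypothesis.Theorems.PfPersistenceGapClassG1
import HarnessLib

/-!
# PF persistence — SECTOR-GENERIC locality at bounded height (pub-rhpf, barrier-typer gen 3; D-ODD binding)

**HONEST FRAMING. This is a long-odds MECHANISM SEARCH; no RH claims.** Every statement below is RH-free
bookkeeping about the cell's observatory records; nothing here bears on the truth of RH.

The admissible-class file types ONE Galerkin block per window, the EVEN block
`evenBlock w win = (n, m) ↦ weil (2a) w (thetaEven (2a) n m)`. Several observatory rows (cand-3 / cand-7 odd sector,
cand-4 C4-I6, cand-6 mixed `eo` readings) read a SECOND block at the same window (the odd sector) or several. Rather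
than vendor a kernel formula for each sector, this file types the block of an ARBITRARY kernel family
`Θ : ℝ → ℕ → ℕ → ℝ → ℝ` (`sectorBlock Θ`; the even block is `sectorBlock thetaEven`, PROVED `rfl`), the multi-sector
datum `sectorDatumOf Θs w` of a family of kernels indexed by any type `ι`, and proves the locality theorems
KERNEL-FREE — they only use that the prime part `WP` of the Weil functional is a finite sum over `primeRange (2a)`:

* `sectorBlock_dial_of_not_mem` / `sectorDatumOf_dial_of_not_mem` (PROVED): a dial at a prime power `p > e^{2a}`
  leaves EVERY sector block at `win` identical;
* `exists_heavyDial_mem_sectorNegative_of_determinedOn_below` (PROVED): if a class `S` of multi-sector data is decided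
  by the windows of height `≤ A` (all truncations, all sectors) and contains `ζ`'s multi-sector datum, then for a prime
  `p > e^{2A}` and some `K > 1` the heavy PRIME dial (an arithmetic, von-Mangoldt-supported table) lies in `S` and is
  form-NEGATIVE in the even sector at the genuine window `(log p, 0)`; finite window sets are a special case
  (`SectorFinitelyDetermined.exists_sectorDeterminedOn_below`);
* `not_sectorSeparates_of_sectorDeterminedOn_below` (PROVED): hence no such class separates `ζ` from the detectably
  negative arithmetic dial data — the sector-free form of barrier wall W1 (T-W1 / T-W1-A of the cell's MEMBERSHIP table),
  which the rows flagged `eo` cite.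

Nothing here asserts what the odd kernel IS; a row binds its sector to `sectorBlock Θ` for the kernel its code uses.
-/

set_option linter.dupNamespace false  -- the mandated namespace repeats `RiemannHypothesis`

noncomputable section

open Real Finset Matrix

namespace Summit.RiemannHypothesis.RiemannHypothesis.Theorems.PfPersistence

/-! ## §1 Sector blocks and their locality -/

/-- the Galerkin block at window `win` of the weight table `w` for an ARBITRARY kernel family `Θ L n m : ℝ → ℝ`
(`L = 2a`): `(n, m) ↦ W(Θ_{n m})`. The even sector is `Θ = thetaEven`; an odd / mixed sector is any other `Θ`. [folklore] -/
def sectorBlock (Θ : ℝ → ℕ → ℕ → ℝ → ℝ) (w : Weights) (win : Window) :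
    Matrix (Fin (win.N + 1)) (Fin (win.N + 1)) ℝ :=
  fun n m => weil (2 * win.a) w (Θ (2 * win.a) n m)

/-- PROVED: the even block is the sector block of `thetaEven`. [folklore] -/
theorem sectorBlock_thetaEven : sectorBlock thetaEven = evenBlock := rfl

/-- **PROVED (LOCALITY, kernel-free)**: a dial at a prime power beyond the reach of the window, `e^{2a} < p`, leaves
EVERY sector block at `win` identical. [folklore] -/
theorem sectorBlock_dial_of_not_mem (Θ : ℝ → ℕ → ℕ → ℝ → ℝ) {p : ℕ} {win : Window}
    (hp : Real.exp (2 * win.a) < p) (K : ℝ) (w : Weights) :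
    sectorBlock Θ (dial p K w) win = sectorBlock Θ w win := by
  ext n m
  simp only [sectorBlock, weil]
  rw [WP_dial_of_not_mem (not_mem_primeRange_iff.2 hp)]

/-- multi-sector data: at each window, one matrix per sector index `i : ι`. [folklore] -/
abbrev SectorDatum (ι : Type) : Type := (win : Window) → ι → Matrix (Fin (win.N + 1)) (Fin (win.N + 1)) ℝ

/-- the multi-sector datum of a weight table for the kernel family `Θs`. [folklore] -/
def sectorDatumOf {ι : Type} (Θs : ι → ℝ → ℕ → ℕ → ℝ → ℝ) (w : Weights) : SectorDatum ι :=
  fun win i => sectorBlock (Θs i) w win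

/-- PROVED: a dial beyond the reach of `win` leaves the whole multi-sector datum at `win` identical. [folklore] -/
theorem sectorDatumOf_dial_of_not_mem {ι : Type} (Θs : ι → ℝ → ℕ → ℕ → ℝ → ℝ) {p : ℕ} {win : Window}
    (hp : Real.exp (2 * win.a) < p) (K : ℝ) (w : Weights) :
    sectorDatumOf Θs (dial p K w) win = sectorDatumOf Θs w win := by
  funext i
  exact sectorBlock_dial_of_not_mem (Θs i) hp K w

/-- PROVED: the even-sector component of the multi-sector datum is the even block. [folklore] -/
theorem sectorDatumOf_apply_of_eq_thetaEven {ι : Type} {Θs : ι → ℝ → ℕ → ℕ → ℝ → ℝ} {i₀ : ι}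
    (hΘ : Θs i₀ = thetaEven) (w : Weights) (win : Window) :
    sectorDatumOf Θs w win i₀ = evenBlock w win := by
  simp only [sectorDatumOf, hΘ, sectorBlock_thetaEven]

/-! ## §2 Classes of multi-sector data decided at bounded height -/

/-- `S` is decided by the windows of `T` (all sectors there). [folklore] -/
def SectorDeterminedOn {ι : Type} (S : Set (SectorDatum ι)) (T : Set Window) : Prop :=
  ∀ d d' : SectorDatum ι, (∀ win ∈ T, d win = d' win) → (d ∈ S ↔ d' ∈ S)

/-- `S` is decided by finitely many windows (all sectors there). [folklore] -/
def SectorFinitelyDetermined {ι : Type} (S : Set (SectorDatum ι)) : Prop :=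
  ∃ W : Finset Window, ∀ d d' : SectorDatum ι, (∀ win ∈ W, d win = d' win) → (d ∈ S ↔ d' ∈ S)

/-- PROVED: finitely determined ⇒ decided below some height. [folklore] -/
theorem SectorFinitelyDetermined.exists_sectorDeterminedOn_below {ι : Type} {S : Set (SectorDatum ι)}
    (h : SectorFinitelyDetermined S) : ∃ A : ℝ, SectorDeterminedOn S (below A) := by
  obtain ⟨W, hW⟩ := h
  refine ⟨∑ win ∈ W, win.a, fun d d' hdd' => hW d d' fun win hwin => hdd' win ?_⟩
  exact Finset.single_le_sum (f := fun win : Window => win.a) (fun w _ => w.ha.le) hwin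

/-- a multi-sector datum is DETECTABLY NEGATIVE: some sector block at some window has a negative Rayleigh quotient. [folklore] -/
def SectorDetectablyNegative {ι : Type} (d : SectorDatum ι) : Prop :=
  ∃ (win : Window) (i : ι) (v : Fin (win.N + 1) → ℝ), v ⬝ᵥ (d win i *ᵥ v) < 0

/-- `S` SEPARATES `d₀` from the detectably negative members of `D` (multi-sector form of `Separates`). [folklore] -/
def SectorSeparates {ι : Type} (S D : Set (SectorDatum ι)) (d₀ : SectorDatum ι) : Prop :=
  d₀ ∈ S ∧ ∀ d ∈ D, SectorDetectablyNegative d → d ∉ S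

/-- PROVED: a prime beyond `e^{2A}` is beyond the reach `e^{2a}` of every window of height `a ≤ A`. [folklore] -/
theorem exp_two_mul_lt_of_ceil_le {A : ℝ} {p : ℕ} (hp : ⌈Real.exp (2 * A)⌉₊ + 1 ≤ p) {win : Window}
    (hwin : win ∈ below A) : Real.exp (2 * win.a) < p := by
  have h1 : Real.exp (2 * win.a) ≤ Real.exp (2 * A) :=
    Real.exp_le_exp.2 (by have : win.a ≤ A := hwin; linarith)
  have h2 : Real.exp (2 * A) ≤ (⌈Real.exp (2 * A)⌉₊ : ℝ) := Nat.le_ceil _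
  have h3 : ((⌈Real.exp (2 * A)⌉₊ + 1 : ℕ) : ℝ) ≤ p := by exact_mod_cast hp
  push_cast at h3
  linarith

/-- **PROVED — SECTOR-FREE LOCALITY BARRIER AT BOUNDED HEIGHT (RH-free), witness NAMED.** If membership in `S` is
decided by the windows of height `≤ A` (all truncations, ALL sectors) and `ζ`'s multi-sector datum is in `S`, then for
a prime `p > e^{2A}` and some `K > 1` the heavy prime dial of `ζ` — an arithmetic (von-Mangoldt-supported) table — has
its multi-sector datum in `S` and is form-negative in the EVEN sector `i₀` at the genuine window `(log p, 0)`. [folklore] -/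
theorem exists_heavyDial_mem_sectorNegative_of_determinedOn_below {ι : Type} {Θs : ι → ℝ → ℕ → ℕ → ℝ → ℝ}
    {i₀ : ι} (hΘ : Θs i₀ = thetaEven) {S : Set (SectorDatum ι)} {A : ℝ} (hS : SectorDeterminedOn S (below A))
    (hζ : sectorDatumOf Θs zetaWeights ∈ S) :
    ∃ (p : ℕ) (hp : p.Prime) (K : ℝ), 1 < K ∧ sectorDatumOf Θs (dial p K zetaWeights) ∈ S ∧
      ∃ v : Fin ((logWindow p hp.two_le).N + 1) → ℝ,
        v ⬝ᵥ (sectorDatumOf Θs (dial p K zetaWeights) (logWindow p hp.two_le) i₀ *ᵥ v) < 0 := by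
  obtain ⟨p, hpB, hp⟩ := Nat.exists_infinite_primes (max (⌈Real.exp (2 * A)⌉₊ + 1) 2)
  have hpB' : ⌈Real.exp (2 * A)⌉₊ + 1 ≤ p := (le_max_left _ 2).trans hpB
  have hp2 : (2 : ℝ) ≤ p := by exact_mod_cast (le_max_right _ 2).trans hpB
  have hlogp : 0 < Real.log p := Real.log_pos (by linarith)
  obtain ⟨K, hK, v, hv⟩ := exists_dial_negative_gt (win := logWindow p hp.two_le) (logWindow p hp.two_le).ha
    (by rw [logWindow_a]; linarith) (zetaWeights_pos_of_prime hp)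
  refine ⟨p, hp, K, hK, ?_, v, ?_⟩
  · refine (hS (sectorDatumOf Θs zetaWeights) _ fun win hwin => ?_).1 hζ
    rw [sectorDatumOf_dial_of_not_mem Θs (exp_two_mul_lt_of_ceil_le hpB' hwin)]
  · rwa [sectorDatumOf_apply_of_eq_thetaEven hΘ]

/-- PROVED (finite window sets): the sector-free form of `exists_heavyDial_mem_negative`. [folklore] -/
theorem exists_heavyDial_mem_sectorNegative {ι : Type} {Θs : ι → ℝ → ℕ → ℕ → ℝ → ℝ} {i₀ : ι}
    (hΘ : Θs i₀ = thetaEven) {S : Set (SectorDatum ι)} (hS : SectorFinitelyDetermined S)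
    (hζ : sectorDatumOf Θs zetaWeights ∈ S) :
    ∃ (p : ℕ) (hp : p.Prime) (K : ℝ), 1 < K ∧ sectorDatumOf Θs (dial p K zetaWeights) ∈ S ∧
      ∃ v : Fin ((logWindow p hp.two_le).N + 1) → ℝ,
        v ⬝ᵥ (sectorDatumOf Θs (dial p K zetaWeights) (logWindow p hp.two_le) i₀ *ᵥ v) < 0 := by
  obtain ⟨A, hA⟩ := hS.exists_sectorDeterminedOn_below
  exact exists_heavyDial_mem_sectorNegative_of_determinedOn_below hΘ hA hζ

/-- **PROVED (sector-free wall W1 at bounded height):** no class of multi-sector data decided below some height separates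
`ζ`'s multi-sector datum from the detectably negative data of the prime dials of `ζ` — for any domain `D` containing the
multi-sector data of all prime dials `dial p K zetaWeights` (arithmetic tables). [folklore] -/
theorem not_sectorSeparates_of_sectorDeterminedOn_below {ι : Type} {Θs : ι → ℝ → ℕ → ℕ → ℝ → ℝ} {i₀ : ι}
    (hΘ : Θs i₀ = thetaEven) {S D : Set (SectorDatum ι)} {A : ℝ}
    (hD : ∀ (p : ℕ) (K : ℝ), p.Prime → sectorDatumOf Θs (dial p K zetaWeights) ∈ D)
    (hS : SectorDeterminedOn S (below A)) : ¬ SectorSeparates S D (sectorDatumOf Θs zetaWeights) := by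
  rintro ⟨hζ, hsep⟩
  obtain ⟨p, hp, K, -, hmem, v, hv⟩ := exists_heavyDial_mem_sectorNegative_of_determinedOn_below hΘ hS hζ
  exact hsep _ (hD p K hp) ⟨logWindow p hp.two_le, i₀, v, hv⟩ hmem

/-- PROVED (finite window sets). [folklore] -/
theorem not_sectorSeparates_of_sectorFinitelyDetermined {ι : Type} {Θs : ι → ℝ → ℕ → ℕ → ℝ → ℝ} {i₀ : ι}
    (hΘ : Θs i₀ = thetaEven) {S D : Set (SectorDatum ι)}
    (hD : ∀ (p : ℕ) (K : ℝ), p.Prime → sectorDatumOf Θs (dial p K zetaWeights) ∈ D)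
    (hS : SectorFinitelyDetermined S) : ¬ SectorSeparates S D (sectorDatumOf Θs zetaWeights) := by
  obtain ⟨A, hA⟩ := hS.exists_sectorDeterminedOn_below
  exact not_sectorSeparates_of_sectorDeterminedOn_below hΘ hD hA

/-! ## §3 Back to one sector: the `Datum`-level barrier at bounded height -/

/-- **PROVED — THE LOCALITY BARRIER AT BOUNDED HEIGHT for `Datum` (RH-free), witness NAMED.** If membership in
`S : Set Datum` is decided by the windows of height `≤ A` (all truncations `N`; `DeterminedOn`, gap-class file) and
`ζ`'s datum is in `S`, then a prime `p > e^{2A}` and some `K > 1` give a heavy prime dial of `ζ` inside `S` that is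
form-negative at the genuine window `(log p, 0)`. Strictly extends `exists_heavyDial_mem_negative` (finite window sets
are height-bounded, `FinitelyDetermined.exists_determinedOn_below`); this is the theorem behind "fixed tests at height
`a₀`, all `N`" rows (`DeterminedOn S (below a₀)`). [folklore] -/
theorem exists_heavyDial_mem_negative_of_determinedOn_below {S : Set Datum} {A : ℝ}
    (hS : DeterminedOn S (below A)) (hζ : zetaDatum ∈ S) :
    ∃ (p : ℕ) (hp : p.Prime) (K : ℝ), 1 < K ∧ datumOf (dial p K zetaWeights) ∈ S ∧
      ∃ v : Fin ((logWindow p hp.two_le).N + 1) → ℝ,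
        v ⬝ᵥ (datumOf (dial p K zetaWeights) (logWindow p hp.two_le) *ᵥ v) < 0 := by
  obtain ⟨p, hpB, hp⟩ := Nat.exists_infinite_primes (max (⌈Real.exp (2 * A)⌉₊ + 1) 2)
  have hpB' : ⌈Real.exp (2 * A)⌉₊ + 1 ≤ p := (le_max_left _ 2).trans hpB
  have hp2 : (2 : ℝ) ≤ p := by exact_mod_cast (le_max_right _ 2).trans hpB
  have hlogp : 0 < Real.log p := Real.log_pos (by linarith)
  obtain ⟨K, hK, v, hv⟩ := exists_dial_negative_gt (win := logWindow p hp.two_le) (logWindow p hp.two_le).ha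
    (by rw [logWindow_a]; linarith) (zetaWeights_pos_of_prime hp)
  refine ⟨p, hp, K, hK, ?_, v, hv⟩
  refine (hS zetaDatum _ fun win hwin => ?_).1 hζ
  show evenBlock zetaWeights win = evenBlock (dial p K zetaWeights) win
  rw [evenBlock_dial_of_not_mem (exp_two_mul_lt_of_ceil_le hpB' hwin)]

/-- PROVED (set form on the integer dial space): a class decided below some height and containing `ζ`'s datum contains a
dial-space datum `≠ ζ` — a PRIME dial, hence an arithmetic table — that is detectably negative. [folklore] -/
theorem determinedOn_below_meets_dialNegativesNe {S : Set Datum} {A : ℝ} (hS : DeterminedOn S (below A))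
    (hζ : zetaDatum ∈ S) : ∃ d ∈ dialSpace, d ≠ zetaDatum ∧ d ∈ S ∧ DetectablyNegative d := by
  obtain ⟨p, hp, K, hK, hmem, v, hv⟩ := exists_heavyDial_mem_negative_of_determinedOn_below hS hζ
  exact ⟨datumOf (dial p K zetaWeights), ⟨_, rfl⟩,
    datumOf_dial_ne hp.two_le hK.ne' (zetaWeights_pos_of_prime hp).ne', hmem, logWindow p hp.two_le, v, hv⟩

/-- **PROVED (wall W1 at bounded height):** a class decided below some height cannot separate `ζ` from the detectably
negative dial data, on any domain containing `dialSpace`. The arithmetic-domain form (domain `⊇ arithDialSpace`) is in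
`PfPersistenceHeightLocality`. [folklore] -/
theorem not_separates_of_determinedOn_below {S D : Set Datum} {A : ℝ} (hD : dialSpace ⊆ D)
    (hS : DeterminedOn S (below A)) : ¬ Separates S D zetaDatum := by
  rintro ⟨hζ, hsep⟩
  obtain ⟨d, hd, -, hdS, hneg⟩ := determinedOn_below_meets_dialNegativesNe hS hζ
  exact hsep d (hD hd) hneg hdS

/-- PROVED: hence a class that separates on a domain `⊇ dialSpace` is NONLOCAL AT EVERY HEIGHT — clause (2) of the gap
class `G1` is NECESSARY, not a stipulation. [folklore] -/
theorem nonlocalAtEveryHeight_of_separates_dialSpace {S D : Set Datum} (hD : dialSpace ⊆ D)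
    (h : Separates S D zetaDatum) : NonlocalAtEveryHeight S :=
  fun _ hA => not_separates_of_determinedOn_below hD hA h

end Summit.RiemannHypothesis.RiemannHypothesis.Theorems.PfPersistence

end
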